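import Summits.BirchSwinnertonDyer.Rank1Residual.Supersingular.KobayashiSqueezeReal
import Summits.BirchSwinnertonDyer.Rank1Residual.Supersingular.SignedSqueezeX7
import Summits.BirchSwinnertonDyer.BirchSwinnertonDyer.Theorems.SignedLowerHalvesKobayashiLowerHalfLargeImageDeepPointAlgebra
import Summits.BirchSwinnertonDyer.BirchSwinnertonDyer.Theorems.SignedBaseChangeEisensteinSqueeze
import Literature.NumberTheory.EllipticCurves.Wuthrich2014.ThreeAdicImageSupersingularProofs
import Literature.NumberTheory.EllipticCurves.NonEisensteinPrimeOfSurjective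
import HarnessLib

/-!
# The Eisenstein half of Kobayashi's main conjecture from ONE DEEP CYCLOTOMIC POINT
# (crux `KobayashiLowerHalfLargeImage`, item stmt-BirchSwinnertonDyer-19001; lead `bsd-line-slh-p1` gen 10)

ROUTE-INDEPENDENT helper (no `Theses` import; `--supports stmt-BirchSwinnertonDyer-19001`). It turns the
lever of the crux-ideate line `Cruxes/KobayashiLowerHalfLargeImage/Lines/rohrlich_squeeze.lean` (k1 g9,
2026-08-28) into kernel theorems on the tree's real objects and DISCHARGES that line's stub
`stub_katoAtPoint` — at EVERY odd good prime, not only `p ≥ 5` — from published named facts.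

HONEST FRAMING. Nothing here proves the crux, Kobayashi's main conjecture or BSD. What is proved:
for an odd prime `p` of good reduction of `E = W` with `a_p = 0` and `ρ̄_{E,p}` onto, and a sign `ε`,
GRANTED BY NAME Kobayashi 2003 Thm. 1.2 (`h12`), Thm. 4.1 (`h41`) and the period-unit facts
`realPeriodRat_eq_unit_mul_plusPeriod` (`h5`, `p ≥ 5`) / `…_three` (`h3`, `p = 3`) — four conjuncts of
the route's `PublishedSignedInputs` —, the Eisenstein divisibility `KobayashiLowerDivisibility W p ε`
(Néron normalisation, `char X^ε = (g)`, `ι g = ϖ · ι(L^ε_p · h)`) FOLLOWS from the same divisibility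
read modulo ONE cyclotomic point `Φ_n = Φ_{pⁿ}(1+T)` of `Λ = ℤ_p⟦T⟧` (`n ≥ 1`) not dividing `L^ε_p`:
`char X^ε = (g)`, `ι(g + Φ_n · c) = ϖ · ι(L^ε_p · h)` for some `h, c ∈ Λ`
(`kobayashiLowerDivisibility_of_deepPoint`; the hypothesis body is VERBATIM the line's predicate
`RohrlichSqueeze.DeepPointLowerDivisibility W p ε`, whose `cycPhi p n` is by `rfl` the power series
`↑(((cyclotomic (p ^ n) ℤ).comp (X + 1)).map (Int.castRingHom ℤ_[p]))` used here). Conversely the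
Eisenstein divisibility gives the one-point form as soon as a non-dividing `Φ_n` exists
(`deepPoint_of_kobayashiLowerDivisibility`, `c = 0`).

## Contents
* §1–§2 (sibling file `…LargeImageDeepPointAlgebra.lean`, imported): one-point rigidity in a local
  ring — if `L = g·k` and `g ≡ L·h (mod q)` with `(q)` proper and `g` a non-zero-divisor mod `q`, then
  `k` is a unit — and the cyclotomic points `Φ_{p^{n+1}}(1+T)` of `Λ` (prime, proper, non-multiples
  are non-zero-divisors, deep points exist at `n = λ(L)`).
* §3 Kato at the point (`katoAtPoint`): on the tree's objects, for a generator `g` of `char X^ε` and a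
  deep point `Φ_n ∤ L^ε_p`: (i) `ι(g·k) = ϖ·ι(L^ε_p)` for some `k ∈ Λ` (Thm. 4.1 integral under the
  `p`-adic tower — tree THEOREM `surjective_pow_of_surj_of_good` from `surj(p)` at a good odd `p` —,
  Thm. 1.2, and `ord_p ϖ = 0`), (ii) `(Φ_n) ≠ ⊤`, (iii) `g` is a non-zero-divisor modulo `Φ_n`
  (`Φ_n` prime, and `Φ_n ∣ g ∣ L^ε_p` is excluded). This is the line's `stub_katoAtPoint`, binders
  widened from `5 ≤ p ∧ ClassX7` to `p ≠ 2 ∧ good ∧ a_p = 0`.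
* §4 The squeeze (`kobayashiLowerDivisibility_of_deepPoint_datum`, `kobayashiLowerDivisibility_of_deepPoint`),
  its UNCONDITIONAL converse (`deepPoint_of_kobayashiLowerDivisibility`: `c = 0` at the deep point
  `n = λ(L^ε_p) + 1`), the equivalence (`kobayashiLowerDivisibility_iff_deepPoint`) and the X7 corollary
  (`kobayashiLowerDivisibility_of_deepPoint_of_classX7`, any odd `p`, `a_p = 0` displayed as in the crux).

References: [Kobayashi2003] Thm. 1.2 (p. 2), Thm. 4.1 (p. 8), Conjecture (p. 2); [Pollack2003] Thm. 5.6,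
Cor. 5.11, Prop. 6.18; [Washington1997] Prop. 7.2, §7.1, §13.2; [GreenbergVatsal2000] §3 Rem. 3.4;
[Wuthrich2014] Lemma 20; [SerreAbelianLadic1968] IV §3.4; [Rohrlich1984] (deep points — here replaced by `λ`).
-/

set_option autoImplicit false
-- single-problem summit (D-0017): the doubled namespace component `BirchSwinnertonDyer` is by design
set_option linter.dupNamespace false

noncomputable section

open scoped Classical MatrixGroups ModularForm

open CongruenceSubgroup Polynomial WeierstrassCurve Literature.NumberTheory.EllipticCurves
  Literature.NumberTheory.EllipticCurves.ModularForms
  Literature.NumberTheory.EllipticCurves.Rank1Residual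
  Literature.NumberTheory.EllipticCurves.Kobayashi2003 ZpExtension
  Summit.BirchSwinnertonDyer.Rank1Residual.Supersingular
  Summit.BirchSwinnertonDyer.BirchSwinnertonDyer.Theorems

namespace Summit.BirchSwinnertonDyer.BirchSwinnertonDyer.Theorems.LargeImageDeepPoint

/-! ## §3 Kato at the point — the line's `stub_katoAtPoint`, discharged at every odd good prime -/

section KatoAtPoint

variable (W : WeierstrassCurve ℚ) [W.IsElliptic] [W.IsGloballyMinimal] (p : ℕ) [hp : Fact p.Prime]

/-- **Kato's signed divisibility in the Néron normalisation** (the normalisation of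
`KobayashiLowerDivisibility`): at an odd good prime `p` with `a_p = 0` and `ρ̄_{E,p}` onto, for every
admissible `(κ, γ, f, ϖ, (L⁺,L⁻))`, every datum `D` of `Sel^ε(E/ℚ_∞)` and every generator `g` of
`char X^ε`: `ι(g·k) = ϖ·ι(L^ε_p)` for some `k ∈ Λ`, AND `g ∣ L^ε_p` in `Λ`. Inputs BY NAME: Kobayashi
Thm. 1.2 (`h12`), Thm. 4.1 (`h41`, integral under the `p`-adic tower, which `surj(p)` gives at a good
odd `p` — tree theorem `surjective_pow_of_surj_of_good`), and `ord_p ϖ = 0` (`h5`/`h3`, `E[p]`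
irreducible from `surj(p)`). [cite: Kobayashi2003, Thm. 1.2 (p. 2) and Thm. 4.1 (p. 8)]
[cite: GreenbergVatsal2000, §3 Remark 3.4] [cite: Wuthrich2014, Lemma 20 (p. 399)] -/
theorem kato_neron (h12 : thm12_signedSelmerDual_finite_torsion)
    (h41 : thm41_signedCharIdeal_divisibility) (h5 : realPeriodRat_eq_unit_mul_plusPeriod)
    (h3 : realPeriodRat_eq_unit_mul_plusPeriod_three)
    (hp2 : p ≠ 2) (hgood : W.HasGoodReductionAtPrime p) (hap : W.frobeniusTrace p = 0)
    (hs : Surj W p) (ε : ℤˣ) (κ : ZpExtension ℚ p) (γ : Field.absoluteGaloisGroup ℚ)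
    (hκ : κ.IsCyclotomic) (hγ : κ.IsTopGenerator γ) (hγ' : IsCyclotomicVariable p γ)
    [NeZero (W.conductorNorm ℤ)] (f : CuspForm (Gamma0 (W.conductorNorm ℤ)) 2)
    (hf : IsNewformOf W f) (ϖ : ℚ) (hϖ : (ϖ : ℝ) * W.realPeriodRat = plusPeriod f)
    (Lplus Lminus : IwasawaAlgebra p) (hPP : IsPollackPair f p Lplus Lminus)
    (D : SignedSelmerDualData W κ γ ε) (g : IwasawaAlgebra p) (hg : D.charIdeal = Ideal.span {g}) :
    (∃ k : IwasawaAlgebra p, iwasawaToPowerSeries p (g * k) =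
        PowerSeries.C (ϖ : ℚ_[p]) * iwasawaToPowerSeries p (kobayashiL ε Lplus Lminus)) ∧
      g ∣ kobayashiL ε Lplus Lminus := by
  haveI hfin : Module.Finite (IwasawaAlgebra p) D.X := h12.moduleFinite hp2 hgood hap hκ hγ D
  have hXt : Module.IsTorsion (IwasawaAlgebra p) D.X := h12.isTorsion hp2 hgood hap hκ hγ D
  set L := kobayashiL ε Lplus Lminus with hL_def
  have hL : IsSignedPAdicLFunction f p ε L := hPP.isSignedPAdicLFunction_kobayashiL ε
  have hsurj : ∀ m : ℕ, W.HasSurjectiveModNGaloisRep (p ^ m : ℕ) :=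
    surjective_pow_of_surj_of_good W p Wuthrich2014.lemma20_surjective_threeAdic_of_semistable_holds
      hp2 hgood hs
  have hU : g ∣ L := h41.dvd_of_charIdeal_eq_span hp2 hgood hap hf hκ hγ hγ' hL D hXt hsurj hg
  refine ⟨?_, hU⟩
  -- the period ratio `ϖ` is a `p`-adic unit
  have hirr : W.HasIrreducibleModPGaloisRep p :=
    hasIrreducibleModPGaloisRep_of_hasSurjectiveModNGaloisRep W p hs
  have hvϖ : padicValRat p ϖ = 0 :=
    padicValRat_periodRatio_eq_zero h5 h3 W p hp2 hgood hirr f hf ϖ hϖ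
  have hϖ0 : ϖ ≠ 0 := by
    intro hz
    rw [hz, Rat.cast_zero, zero_mul] at hϖ
    exact (IsNewform0.plusPeriod_pos_holds hf.1 hf.coeffField_eq_bot).ne' hϖ.symm
  obtain ⟨u, hu⟩ := exists_units_coe_eq_ratCast hϖ0 hvϖ
  obtain ⟨k₀, hk₀⟩ := hU
  refine ⟨PowerSeries.C (u : ℤ_[p]) * k₀, ?_⟩
  rw [show g * (PowerSeries.C (u : ℤ_[p]) * k₀) = PowerSeries.C (u : ℤ_[p]) * (g * k₀) by ring,
    ← hk₀, (span_C_units_mul_eq u L).2, hu]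

/-- **KATO AT THE POINT** — the line's `stub_katoAtPoint` (`Lines/rohrlich_squeeze.lean`), PROVED with
binders widened from `5 ≤ p ∧ ClassX7 ∧ ¬CM` to `p ≠ 2 ∧ good ∧ a_p = 0` (granted `h12`, `h41`, `h5`,
`h3` BY NAME): for a generator `g` of `char X^ε` and a deep point `Φ_n` (`n ≥ 1`, `Φ_n ∤ L^ε_p`):
(i) `ι(g·k) = ϖ·ι(L^ε_p)` for some `k`; (ii) `(Φ_n) ≠ ⊤`; (iii) `g` is a non-zero-divisor modulo
`Φ_n` (`Φ_n` is prime in `Λ`, §2, and `Φ_n ∣ g ∣ L^ε_p` is excluded by the deep-point hypothesis).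
[cite: Kobayashi2003, Thm. 1.2 (p. 2) and Thm. 4.1 (p. 8)] [cite: Washington1997, Prop. 7.2 and §13.2]
[cite: GreenbergVatsal2000, §3 Remark 3.4] -/
theorem katoAtPoint (h12 : thm12_signedSelmerDual_finite_torsion)
    (h41 : thm41_signedCharIdeal_divisibility) (h5 : realPeriodRat_eq_unit_mul_plusPeriod)
    (h3 : realPeriodRat_eq_unit_mul_plusPeriod_three)
    (hp2 : p ≠ 2) (hgood : W.HasGoodReductionAtPrime p) (hap : W.frobeniusTrace p = 0)
    (hs : Surj W p) (ε : ℤˣ) (κ : ZpExtension ℚ p) (γ : Field.absoluteGaloisGroup ℚ)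
    (hκ : κ.IsCyclotomic) (hγ : κ.IsTopGenerator γ) (hγ' : IsCyclotomicVariable p γ)
    [NeZero (W.conductorNorm ℤ)] (f : CuspForm (Gamma0 (W.conductorNorm ℤ)) 2)
    (hf : IsNewformOf W f) (ϖ : ℚ) (hϖ : (ϖ : ℝ) * W.realPeriodRat = plusPeriod f)
    (Lplus Lminus : IwasawaAlgebra p) (hPP : IsPollackPair f p Lplus Lminus)
    (D : SignedSelmerDualData W κ γ ε) (g : IwasawaAlgebra p) (hg : D.charIdeal = Ideal.span {g})
    (n : ℕ) (hn : 1 ≤ n)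
    (hndvd : ¬ (((((cyclotomic (p ^ n) ℤ).comp (X + 1)).map (Int.castRingHom ℤ_[p]) :
      ℤ_[p][X]) : PowerSeries ℤ_[p]) ∣ kobayashiL ε Lplus Lminus)) :
    (∃ k : IwasawaAlgebra p, iwasawaToPowerSeries p (g * k) =
        PowerSeries.C (ϖ : ℚ_[p]) * iwasawaToPowerSeries p (kobayashiL ε Lplus Lminus)) ∧
      Ideal.span {((((cyclotomic (p ^ n) ℤ).comp (X + 1)).map (Int.castRingHom ℤ_[p]) :
        ℤ_[p][X]) : PowerSeries ℤ_[p])} ≠ ⊤ ∧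
      (∀ r : IwasawaAlgebra p,
        g * r ∈ Ideal.span {((((cyclotomic (p ^ n) ℤ).comp (X + 1)).map (Int.castRingHom ℤ_[p]) :
          ℤ_[p][X]) : PowerSeries ℤ_[p])} →
        r ∈ Ideal.span {((((cyclotomic (p ^ n) ℤ).comp (X + 1)).map (Int.castRingHom ℤ_[p]) :
          ℤ_[p][X]) : PowerSeries ℤ_[p])}) := by
  obtain ⟨hk, hU⟩ := kato_neron W p h12 h41 h5 h3 hp2 hgood hap hs ε κ γ hκ hγ hγ' f hf ϖ hϖ
    Lplus Lminus hPP D g hg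
  obtain ⟨m, rfl⟩ : ∃ m, n = m + 1 := ⟨n - 1, by omega⟩
  refine ⟨hk, span_coe_cyclotomic_ne_top p m, fun r hr => ?_⟩
  exact mem_span_coe_cyclotomic_of_mul_mem p m (fun hΦg => hndvd (hΦg.trans hU)) r hr

end KatoAtPoint

/-! ## §4 The squeeze: the Eisenstein half from ONE deep point, and back -/

section Squeeze

variable (W : WeierstrassCurve ℚ) [W.IsElliptic] [W.IsGloballyMinimal] (p : ℕ) [hp : Fact p.Prime]

/-- **The squeeze, per datum.** Odd good `p`, `a_p = 0`, `ρ̄_{E,p}` onto; granted `h12`, `h41`, `h5`,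
`h3` BY NAME. If for an admissible `(κ, γ, f, ϖ, (L⁺,L⁻))` and a datum `D` of `Sel^ε(E/ℚ_∞)` the
Eisenstein divisibility holds MODULO ONE DEEP POINT — `char X^ε = (g)` and
`ι(g + Φ_n·c) = ϖ·ι(L^ε_p·h)` for some `n ≥ 1` with `Φ_n ∤ L^ε_p` and some `h, c ∈ Λ` —, then it
holds in `Λ`: `ι g = ϖ·ι(L^ε_p·h')` for some `h' ∈ Λ`. Proof: Kato at the point (§3) gives
`ι(g k) = ϖ ι L^ε_p`, so `g + Φ_n c = g k h` in `Λ` (`ι` injective); one-point rigidity (§1) makes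
`k` a unit; `h' = k⁻¹`. [cite: Kobayashi2003, Thm. 1.2, Thm. 4.1 and Conjecture (p. 2)]
[cite: Washington1997, Prop. 7.2 and §13.2] [cite: GreenbergVatsal2000, §3 Remark 3.4] -/
theorem kobayashiLowerDivisibility_of_deepPoint_datum (h12 : thm12_signedSelmerDual_finite_torsion)
    (h41 : thm41_signedCharIdeal_divisibility) (h5 : realPeriodRat_eq_unit_mul_plusPeriod)
    (h3 : realPeriodRat_eq_unit_mul_plusPeriod_three)
    (hp2 : p ≠ 2) (hgood : W.HasGoodReductionAtPrime p) (hap : W.frobeniusTrace p = 0)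
    (hs : Surj W p) (ε : ℤˣ) (κ : ZpExtension ℚ p) (γ : Field.absoluteGaloisGroup ℚ)
    (hκ : κ.IsCyclotomic) (hγ : κ.IsTopGenerator γ) (hγ' : IsCyclotomicVariable p γ)
    [NeZero (W.conductorNorm ℤ)] (f : CuspForm (Gamma0 (W.conductorNorm ℤ)) 2)
    (hf : IsNewformOf W f) (ϖ : ℚ) (hϖ : (ϖ : ℝ) * W.realPeriodRat = plusPeriod f)
    (Lplus Lminus : IwasawaAlgebra p) (hPP : IsPollackPair f p Lplus Lminus)
    (D : SignedSelmerDualData W κ γ ε) (g : IwasawaAlgebra p) (hg : D.charIdeal = Ideal.span {g})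
    (n : ℕ) (hn : 1 ≤ n)
    (hndvd : ¬ (((((cyclotomic (p ^ n) ℤ).comp (X + 1)).map (Int.castRingHom ℤ_[p]) :
      ℤ_[p][X]) : PowerSeries ℤ_[p]) ∣ kobayashiL ε Lplus Lminus))
    (h c : IwasawaAlgebra p)
    (hι : iwasawaToPowerSeries p (g + ((((cyclotomic (p ^ n) ℤ).comp (X + 1)).map
        (Int.castRingHom ℤ_[p]) : ℤ_[p][X]) : PowerSeries ℤ_[p]) * c) =
      PowerSeries.C (ϖ : ℚ_[p]) * iwasawaToPowerSeries p (kobayashiL ε Lplus Lminus * h)) :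
    ∃ h' : IwasawaAlgebra p, iwasawaToPowerSeries p g =
      PowerSeries.C (ϖ : ℚ_[p]) * iwasawaToPowerSeries p (kobayashiL ε Lplus Lminus * h') := by
  obtain ⟨⟨k, hk⟩, hqtop, hnzd⟩ := katoAtPoint W p h12 h41 h5 h3 hp2 hgood hap hs ε κ γ hκ hγ hγ'
    f hf ϖ hϖ Lplus Lminus hPP D g hg n hn hndvd
  have hpoint : g + ((((cyclotomic (p ^ n) ℤ).comp (X + 1)).map (Int.castRingHom ℤ_[p]) :
      ℤ_[p][X]) : PowerSeries ℤ_[p]) * c = (g * k) * h := by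
    apply iwasawaToPowerSeries_injective p
    rw [hι, map_mul (iwasawaToPowerSeries p) (g * k) h, hk, map_mul, mul_assoc]
  have hunit : IsUnit k := isUnit_cofactor_of_pointCongruence hqtop hnzd rfl hpoint
  obtain ⟨u, hu⟩ := hunit
  refine ⟨↑u⁻¹, ?_⟩
  have hgu : g = g * k * ↑u⁻¹ := by rw [← hu, mul_assoc, Units.mul_inv, mul_one]
  calc iwasawaToPowerSeries p g
      = iwasawaToPowerSeries p (g * k * ↑u⁻¹) := by rw [← hgu]
    _ = iwasawaToPowerSeries p (g * k) * iwasawaToPowerSeries p ↑u⁻¹ := map_mul _ _ _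
    _ = PowerSeries.C (ϖ : ℚ_[p]) * iwasawaToPowerSeries p (kobayashiL ε Lplus Lminus) *
          iwasawaToPowerSeries p ↑u⁻¹ := by rw [hk]
    _ = PowerSeries.C (ϖ : ℚ_[p]) * iwasawaToPowerSeries p (kobayashiL ε Lplus Lminus * ↑u⁻¹) := by
          rw [map_mul, mul_assoc]

/-- **THE SQUEEZE — the Eisenstein half of Kobayashi's main conjecture for `(E, p, ε)` from its
ONE-DEEP-POINT form.** Odd good `p`, `a_p = 0`, `ρ̄_{E,p}` onto; granted BY NAME Kobayashi Thm. 1.2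
(`h12`), Thm. 4.1 (`h41`) and the period-unit facts (`h5`, `h3`). Hypothesis `hC` is VERBATIM the body
of the line predicate `RohrlichSqueeze.DeepPointLowerDivisibility W p ε`: for every admissible
`(κ, γ, f, ϖ, (L⁺,L⁻), D)` there are `n ≥ 1` with `Φ_n ∤ L^ε_p` and `g, h, c ∈ Λ` with
`char X^ε = (g)`, `ι(g + Φ_n c) = ϖ ι(L^ε_p h)`. Conclusion: `KobayashiLowerDivisibility W p ε`.
Nothing about ranks, `T = 0`, regulators or Tamagawa numbers enters. [cite: Kobayashi2003, Thm. 1.2, Thm. 4.1 and Conjecture (p. 2)]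
[cite: Washington1997, Prop. 7.2 and §13.2] [cite: GreenbergVatsal2000, §3 Remark 3.4] [cite: Wuthrich2014, Lemma 20] -/
theorem kobayashiLowerDivisibility_of_deepPoint (h12 : thm12_signedSelmerDual_finite_torsion)
    (h41 : thm41_signedCharIdeal_divisibility) (h5 : realPeriodRat_eq_unit_mul_plusPeriod)
    (h3 : realPeriodRat_eq_unit_mul_plusPeriod_three)
    (hp2 : p ≠ 2) (hgood : W.HasGoodReductionAtPrime p) (hap : W.frobeniusTrace p = 0)
    (hs : Surj W p) (ε : ℤˣ)
    (hC : ∀ (κ : ZpExtension ℚ p) (γ : Field.absoluteGaloisGroup ℚ),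
      κ.IsCyclotomic → κ.IsTopGenerator γ → IsCyclotomicVariable p γ →
    ∀ [NeZero (W.conductorNorm ℤ)] (f : CuspForm (Gamma0 (W.conductorNorm ℤ)) 2),
      IsNewformOf W f → ∀ (ϖ : ℚ), (ϖ : ℝ) * W.realPeriodRat = plusPeriod f →
    ∀ (Lplus Lminus : IwasawaAlgebra p), IsPollackPair f p Lplus Lminus →
    ∀ (D : SignedSelmerDualData W κ γ ε),
      ∃ n : ℕ, 1 ≤ n ∧ ¬ (((((cyclotomic (p ^ n) ℤ).comp (X + 1)).map (Int.castRingHom ℤ_[p]) :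
        ℤ_[p][X]) : PowerSeries ℤ_[p]) ∣ kobayashiL ε Lplus Lminus) ∧
        ∃ g h c : IwasawaAlgebra p, D.charIdeal = Ideal.span {g} ∧
          iwasawaToPowerSeries p (g + ((((cyclotomic (p ^ n) ℤ).comp (X + 1)).map
            (Int.castRingHom ℤ_[p]) : ℤ_[p][X]) : PowerSeries ℤ_[p]) * c) =
            PowerSeries.C (ϖ : ℚ_[p]) * iwasawaToPowerSeries p (kobayashiL ε Lplus Lminus * h)) :
    KobayashiLowerDivisibility W p ε := by
  intro κ γ hκ hγ hγ' _ f hf ϖ hϖ Lplus Lminus hPP D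
  obtain ⟨n, hn, hndvd, g, h, c, hg, hι⟩ := hC κ γ hκ hγ hγ' f hf ϖ hϖ Lplus Lminus hPP D
  obtain ⟨h', hh'⟩ := kobayashiLowerDivisibility_of_deepPoint_datum W p h12 h41 h5 h3 hp2 hgood hap hs
    ε κ γ hκ hγ hγ' f hf ϖ hϖ Lplus Lminus hPP D g hg n hn hndvd h c hι
  exact ⟨g, h', hg, hh'⟩

/-- **Converse (UNCONDITIONAL): the Eisenstein half implies its one-deep-point form** — take `c = 0` at
the deep point `n = λ(L^ε_p) + 1` (`L^ε_p ≠ 0` by Pollack Cor. 5.11, carried by `IsPollackPair` — tree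
`SignedBaseChangeEisensteinSqueeze.kobayashiL_ne_zero`; `exists_not_coe_cyclotomic_dvd`). [cite: Kobayashi2003, Conjecture (p. 2)] [cite: Pollack2003, Cor. 5.11] -/
theorem deepPoint_of_kobayashiLowerDivisibility {ε : ℤˣ} (hK : KobayashiLowerDivisibility W p ε) :
    ∀ (κ : ZpExtension ℚ p) (γ : Field.absoluteGaloisGroup ℚ),
      κ.IsCyclotomic → κ.IsTopGenerator γ → IsCyclotomicVariable p γ →
    ∀ [NeZero (W.conductorNorm ℤ)] (f : CuspForm (Gamma0 (W.conductorNorm ℤ)) 2),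
      IsNewformOf W f → ∀ (ϖ : ℚ), (ϖ : ℝ) * W.realPeriodRat = plusPeriod f →
    ∀ (Lplus Lminus : IwasawaAlgebra p), IsPollackPair f p Lplus Lminus →
    ∀ (D : SignedSelmerDualData W κ γ ε),
      ∃ n : ℕ, 1 ≤ n ∧ ¬ (((((cyclotomic (p ^ n) ℤ).comp (X + 1)).map (Int.castRingHom ℤ_[p]) :
        ℤ_[p][X]) : PowerSeries ℤ_[p]) ∣ kobayashiL ε Lplus Lminus) ∧
        ∃ g h c : IwasawaAlgebra p, D.charIdeal = Ideal.span {g} ∧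
          iwasawaToPowerSeries p (g + ((((cyclotomic (p ^ n) ℤ).comp (X + 1)).map
            (Int.castRingHom ℤ_[p]) : ℤ_[p][X]) : PowerSeries ℤ_[p]) * c) =
            PowerSeries.C (ϖ : ℚ_[p]) * iwasawaToPowerSeries p (kobayashiL ε Lplus Lminus * h) := by
  intro κ γ hκ hγ hγ' _ f hf ϖ hϖ Lplus Lminus hL D
  obtain ⟨g, h, hg, hι⟩ := hK κ γ hκ hγ hγ' f hf ϖ hϖ Lplus Lminus hL D
  obtain ⟨n, hn, hndvd⟩ := exists_not_coe_cyclotomic_dvd p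
    (SignedBaseChangeEisensteinSqueeze.kobayashiL_ne_zero hL ε)
  exact ⟨n, hn, hndvd, g, h, 0, hg, by rw [mul_zero, add_zero, hι]⟩

/-- **EQUIVALENCE.** At an odd good prime `p` with `a_p = 0` and `ρ̄_{E,p}` onto, granted BY NAME
Kobayashi Thm. 1.2 / Thm. 4.1 and the period-unit facts: the Eisenstein half of Kobayashi's main
conjecture for `(E, p, ε)` ⟺ its ONE-DEEP-POINT form (the line predicate `DeepPointLowerDivisibility W p ε`,
body verbatim). [cite: Kobayashi2003, Thm. 1.2, Thm. 4.1 and Conjecture (p. 2)] [cite: Washington1997, Prop. 7.2, §7.1] -/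
theorem kobayashiLowerDivisibility_iff_deepPoint (h12 : thm12_signedSelmerDual_finite_torsion)
    (h41 : thm41_signedCharIdeal_divisibility) (h5 : realPeriodRat_eq_unit_mul_plusPeriod)
    (h3 : realPeriodRat_eq_unit_mul_plusPeriod_three)
    (hp2 : p ≠ 2) (hgood : W.HasGoodReductionAtPrime p) (hap : W.frobeniusTrace p = 0)
    (hs : Surj W p) (ε : ℤˣ) :
    KobayashiLowerDivisibility W p ε ↔
    ∀ (κ : ZpExtension ℚ p) (γ : Field.absoluteGaloisGroup ℚ),
      κ.IsCyclotomic → κ.IsTopGenerator γ → IsCyclotomicVariable p γ →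
    ∀ [NeZero (W.conductorNorm ℤ)] (f : CuspForm (Gamma0 (W.conductorNorm ℤ)) 2),
      IsNewformOf W f → ∀ (ϖ : ℚ), (ϖ : ℝ) * W.realPeriodRat = plusPeriod f →
    ∀ (Lplus Lminus : IwasawaAlgebra p), IsPollackPair f p Lplus Lminus →
    ∀ (D : SignedSelmerDualData W κ γ ε),
      ∃ n : ℕ, 1 ≤ n ∧ ¬ (((((cyclotomic (p ^ n) ℤ).comp (X + 1)).map (Int.castRingHom ℤ_[p]) :
        ℤ_[p][X]) : PowerSeries ℤ_[p]) ∣ kobayashiL ε Lplus Lminus) ∧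
        ∃ g h c : IwasawaAlgebra p, D.charIdeal = Ideal.span {g} ∧
          iwasawaToPowerSeries p (g + ((((cyclotomic (p ^ n) ℤ).comp (X + 1)).map
            (Int.castRingHom ℤ_[p]) : ℤ_[p][X]) : PowerSeries ℤ_[p]) * c) =
            PowerSeries.C (ϖ : ℚ_[p]) * iwasawaToPowerSeries p (kobayashiL ε Lplus Lminus * h) :=
  ⟨fun hK => deepPoint_of_kobayashiLowerDivisibility W p hK,
    fun hC => kobayashiLowerDivisibility_of_deepPoint W p h12 h41 h5 h3 hp2 hgood hap hs ε hC⟩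

/-- **X7 corollary (the crux's binders, every odd `p`).** On class X7 (good supersingular `p`, `E` not
semistable) with `a_p = 0` and `ρ̄_{E,p}` onto — the hypotheses of `KobayashiLowerHalfLargeImage` at
a pair, `¬CM` not needed —, the one-deep-point form of the Eisenstein divisibility for a sign `ε`
implies `KobayashiLowerDivisibility W p ε`, granted `h12`, `h41`, `h5`, `h3`. So the line's
`stub_three` is NOT a separate obligation of the squeeze: at `p = 3` Kato's integrality holds on
X7∧surj(3) by the tree theorem `surjective_pow_of_surj_of_good` (Wuthrich Lemma 20, good case).
[cite: Kobayashi2003, Thm. 1.2, Thm. 4.1 and Conjecture (p. 2)] [cite: Wuthrich2014, Lemma 20 (p. 399)] -/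
theorem kobayashiLowerDivisibility_of_deepPoint_of_classX7 (h12 : thm12_signedSelmerDual_finite_torsion)
    (h41 : thm41_signedCharIdeal_divisibility) (h5 : realPeriodRat_eq_unit_mul_plusPeriod)
    (h3 : realPeriodRat_eq_unit_mul_plusPeriod_three)
    (hp2 : p ≠ 2) (hX : ClassX7 W p) (hap : W.frobeniusTrace p = 0) (hs : Surj W p) (ε : ℤˣ)
    (hC : ∀ (κ : ZpExtension ℚ p) (γ : Field.absoluteGaloisGroup ℚ),
      κ.IsCyclotomic → κ.IsTopGenerator γ → IsCyclotomicVariable p γ →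
    ∀ [NeZero (W.conductorNorm ℤ)] (f : CuspForm (Gamma0 (W.conductorNorm ℤ)) 2),
      IsNewformOf W f → ∀ (ϖ : ℚ), (ϖ : ℝ) * W.realPeriodRat = plusPeriod f →
    ∀ (Lplus Lminus : IwasawaAlgebra p), IsPollackPair f p Lplus Lminus →
    ∀ (D : SignedSelmerDualData W κ γ ε),
      ∃ n : ℕ, 1 ≤ n ∧ ¬ (((((cyclotomic (p ^ n) ℤ).comp (X + 1)).map (Int.castRingHom ℤ_[p]) :
        ℤ_[p][X]) : PowerSeries ℤ_[p]) ∣ kobayashiL ε Lplus Lminus) ∧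
        ∃ g h c : IwasawaAlgebra p, D.charIdeal = Ideal.span {g} ∧
          iwasawaToPowerSeries p (g + ((((cyclotomic (p ^ n) ℤ).comp (X + 1)).map
            (Int.castRingHom ℤ_[p]) : ℤ_[p][X]) : PowerSeries ℤ_[p]) * c) =
            PowerSeries.C (ϖ : ℚ_[p]) * iwasawaToPowerSeries p (kobayashiL ε Lplus Lminus * h)) :
    KobayashiLowerDivisibility W p ε :=
  kobayashiLowerDivisibility_of_deepPoint W p h12 h41 h5 h3 hp2 hX.1.1 hap hs ε hC

end Squeeze

end Summit.BirchSwinnertonDyer.BirchSwinnertonDyer.Theorems.LargeImageDeepPoint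

end
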